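import Summits.CriticalPhenomena.SAWScalingLimit.Theorems.SAWDevelopingMapHexConjectureKPDefs
import HarnessLib

/-!
# Crux `HexConjecture` (stmt-CriticalPhenomena-0808), line `root-locality-replaces-loewner`:
crossings of the slanted lines `slev = i ∣ i+1` by walk lists (Krachun–Panagiotis, §3.1)

Landing target:
`Summits/CriticalPhenomena/SAWScalingLimit/Theorems/SAWDevelopingMapHexConjectureKPCrossings.lean`
(`--supports stmt-CriticalPhenomena-0808`; registered stub `stub_kp_crossings`).

`crossCount i P` (`…KPDefs.lean`) is the number of consecutive pairs `(P[j], P[j+1])` of a vertex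
list of the honeycomb model `HV` whose slanted levels `slev = x₀ + x₁ + b` are `{i, i+1}` (in either
order), i.e. the number of crossings of Krachun–Panagiotis's line `i + 1/2 + e^{2πi/3}ℝ`; a renewal
time of a walk is an `i` with exactly one crossing.  This file proves the elementary facts about
`crossCount` used by the renewal-multiplicity arguments of [KP, §3.1–3.2]:

* the recursion `crossCount_cons_cons` and the splitting formula `crossCount_append_cons`
  (cutting a list at a vertex, which then belongs to both halves);
* (1) `crossCount_le_append`: monotone under appending;
* (2) `crossCount_append_eq`: appending vertices of `slev ≥ i+1` after a last vertex of
  `slev ≥ i+1` creates no crossing of line `i`;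
* (3) `one_le_crossCount`: discrete intermediate value — along an edge `slev` changes by `0` or
  `±1` (`slev_sub_of_adj`), so a chain from `slev ≤ i` to `slev ≥ i+1` crosses line `i`;
* (4) `rightWalks_crossings`: a walk of `T_k` to its right side ("`k` is a renewal time whenever the
  walk ends on the right side of Tria_{2k+1}") crosses line `k` exactly once, all its vertices but
  the outer end have `slev ≤ k`, the outer end has `slev = k+1`, and the exit height lies in
  `[0, 2k]`;
* (5) `eq_of_adj_of_slev_eq_succ`: the only edges raising `slev` by one are
  `(x₀,x₁,false) → (x₀,x₁,true)` (the right darts),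

assembled into the registered conjunction `stub_kp_crossings`.
Sources: Krachun–Panagiotis (arXiv:2310.17299) §3.1; Glazman–Manolescu 2020 §4.1 (the triangle
`T_L` and its right side).
-/

noncomputable section

open Finset
open Literature.Probability.RandomPlanarGeometry.SAW Literature.Probability.RandomPlanarGeometry.SAW.HV

namespace Summit.CriticalPhenomena.SAWScalingLimit.Theorems.HexConjecture.RootLocality

/-! ### Recursion and splitting for `crossCount` -/

/-- The empty list crosses no line. [folklore] -/
@[simp] theorem crossCount_nil (i : ℤ) : crossCount i [] = 0 := rfl

/-- A single vertex crosses no line. [folklore] -/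
@[simp] theorem crossCount_singleton (i : ℤ) (a : HV) : crossCount i [a] = 0 := by
  simp [crossCount]

/-- **Recursion**: the crossings of line `i` by `a :: b :: l` are those of `b :: l`, plus one if the
first pair `(a, b)` has slanted levels `{i, i+1}`. [cite: KrachunPanagiotis2026, §3.1] -/
theorem crossCount_cons_cons (i : ℤ) (a b : HV) (l : List HV) :
    crossCount i (a :: b :: l) = crossCount i (b :: l) +
      if (slev a = i ∧ slev b = i + 1) ∨ (slev a = i + 1 ∧ slev b = i) then 1 else 0 := by
  by_cases h : (slev a = i ∧ slev b = i + 1) ∨ (slev a = i + 1 ∧ slev b = i)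
  · rw [if_pos h]
    simp [crossCount, h]
  · rw [if_neg h]
    simp [crossCount, h]

/-- A first pair crossing line `i` adds one crossing. [cite: KrachunPanagiotis2026, §3.1] -/
theorem crossCount_cons_cons_of_pos {i : ℤ} {a b : HV} (l : List HV)
    (h : (slev a = i ∧ slev b = i + 1) ∨ (slev a = i + 1 ∧ slev b = i)) :
    crossCount i (a :: b :: l) = crossCount i (b :: l) + 1 := by
  rw [crossCount_cons_cons, if_pos h]

/-- A first pair not crossing line `i` adds nothing. [cite: KrachunPanagiotis2026, §3.1] -/
theorem crossCount_cons_cons_of_neg {i : ℤ} {a b : HV} (l : List HV)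
    (h : ¬ ((slev a = i ∧ slev b = i + 1) ∨ (slev a = i + 1 ∧ slev b = i))) :
    crossCount i (a :: b :: l) = crossCount i (b :: l) := by
  rw [crossCount_cons_cons, if_neg h, Nat.add_zero]

/-- Prepending a vertex does not decrease the number of crossings. [folklore] -/
theorem crossCount_le_cons (i : ℤ) (a : HV) (l : List HV) : crossCount i l ≤ crossCount i (a :: l) := by
  cases l with
  | nil => rw [crossCount_nil]; exact Nat.zero_le _
  | cons b l => rw [crossCount_cons_cons]; exact Nat.le_add_right _ _

/-- **Splitting at a vertex**: the crossings of `l₁ ++ a :: l₂` are those of `l₁ ++ [a]` plus those of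
`a :: l₂` (the cut vertex `a` belongs to both halves, so no consecutive pair is lost).
[cite: KrachunPanagiotis2026, §3.1] -/
theorem crossCount_append_cons (i : ℤ) : ∀ (l₁ : List HV) (a : HV) (l₂ : List HV),
    crossCount i (l₁ ++ a :: l₂) = crossCount i (l₁ ++ [a]) + crossCount i (a :: l₂)
  | [], a, l₂ => by simp
  | [b], a, l₂ => by
    simp only [List.singleton_append, crossCount_cons_cons, crossCount_singleton]
    omega
  | b :: c :: l, a, l₂ => by
    have ih := crossCount_append_cons i (c :: l) a l₂
    simp only [List.cons_append] at ih
    simp only [List.cons_append, crossCount_cons_cons]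
    omega

/-- No vertex of slanted level `≤ i` means no crossing of line `i`. [cite: KrachunPanagiotis2026, §3.1] -/
theorem crossCount_eq_zero_of_forall_ge (i : ℤ) :
    ∀ (l : List HV), (∀ v ∈ l, i + 1 ≤ slev v) → crossCount i l = 0
  | [], _ => rfl
  | [_], _ => crossCount_singleton i _
  | a :: b :: l, h => by
    have ha := h a (by simp)
    have hb := h b (by simp)
    have hn : ¬ ((slev a = i ∧ slev b = i + 1) ∨ (slev a = i + 1 ∧ slev b = i)) := by omega
    rw [crossCount_cons_cons_of_neg l hn]
    exact crossCount_eq_zero_of_forall_ge i (b :: l) fun v hv => h v (List.mem_cons_of_mem a hv)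

/-- No vertex of slanted level `≥ i+1` means no crossing of line `i`. [cite: KrachunPanagiotis2026, §3.1] -/
theorem crossCount_eq_zero_of_forall_le (i : ℤ) :
    ∀ (l : List HV), (∀ v ∈ l, slev v ≤ i) → crossCount i l = 0
  | [], _ => rfl
  | [_], _ => crossCount_singleton i _
  | a :: b :: l, h => by
    have ha := h a (by simp)
    have hb := h b (by simp)
    have hn : ¬ ((slev a = i ∧ slev b = i + 1) ∨ (slev a = i + 1 ∧ slev b = i)) := by omega
    rw [crossCount_cons_cons_of_neg l hn]
    exact crossCount_eq_zero_of_forall_le i (b :: l) fun v hv => h v (List.mem_cons_of_mem a hv)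

/-! ### (1), (2): appending -/

/-- **(1) Monotonicity under appending**: a prefix has at most as many crossings of any line.
[cite: KrachunPanagiotis2026, §3.1] -/
theorem crossCount_le_append (i : ℤ) (l₁ l₂ : List HV) :
    crossCount i l₁ ≤ crossCount i (l₁ ++ l₂) := by
  induction l₁ with
  | nil => exact Nat.zero_le _
  | cons a t ih =>
    cases t with
    | nil => rw [crossCount_singleton]; exact Nat.zero_le _
    | cons b l =>
      simp only [List.cons_append] at ih ⊢
      rw [crossCount_cons_cons, crossCount_cons_cons]
      exact Nat.add_le_add_right ih _

/-- **(2) Appending above the line creates no crossing**: if every vertex of `l₂` and the last vertex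
of `l₁` have slanted level `≥ i+1`, then `l₁ ++ l₂` crosses line `i` exactly as often as `l₁`.
[cite: KrachunPanagiotis2026, §3.1] -/
theorem crossCount_append_eq (i : ℤ) (l₁ l₂ : List HV) (h₂ : ∀ v ∈ l₂, i + 1 ≤ slev v)
    (h₁ : ∀ v ∈ l₁.getLast?, i + 1 ≤ slev v) : crossCount i (l₁ ++ l₂) = crossCount i l₁ := by
  induction l₁ with
  | nil => simpa using crossCount_eq_zero_of_forall_ge i l₂ h₂
  | cons a t ih =>
    cases t with
    | nil =>
      rw [List.singleton_append, crossCount_singleton]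
      refine crossCount_eq_zero_of_forall_ge i (a :: l₂) ?_
      rw [List.forall_mem_cons]
      exact ⟨h₁ a (by simp), h₂⟩
    | cons b l =>
      rw [List.getLast?_cons_cons] at h₁
      have ih' := ih h₁
      simp only [List.cons_append] at ih' ⊢
      rw [crossCount_cons_cons, crossCount_cons_cons, ih']

/-! ### (3): the discrete intermediate value property -/

/-- A chain of `ℍ` starting at slanted level `≤ i` and ending at slanted level `≥ i+1` crosses line
`i` (along an edge `slev` moves by at most one, `slev_sub_of_adj`). [cite: KrachunPanagiotis2026, §3.1] -/
theorem one_le_crossCount_cons (i : ℤ) : ∀ (a : HV) (l : List HV), (a :: l).IsChain hvGraph.Adj →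
    slev a ≤ i → (∃ v ∈ (a :: l).getLast?, i + 1 ≤ slev v) → 1 ≤ crossCount i (a :: l)
  | a, [], _, ha, hl => by
    simp only [List.getLast?_singleton, Option.mem_def, Option.some.injEq, exists_eq_left'] at hl
    omega
  | a, b :: l, hc, ha, hl => by
    rw [List.isChain_cons_cons] at hc
    rw [List.getLast?_cons_cons] at hl
    by_cases hb : slev b ≤ i
    · exact (one_le_crossCount_cons i b l hc.2 hb hl).trans (crossCount_le_cons i a (b :: l))
    · rcases slev_sub_of_adj hc.1 with h | h | h
      · omega
      · have h1 : slev a = i := by omega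
        have h2 : slev b = i + 1 := by omega
        rw [crossCount_cons_cons_of_pos l (Or.inl ⟨h1, h2⟩)]
        exact Nat.le_add_left 1 _
      · omega

/-- **(3) Discrete intermediate value**: an `hvGraph`-chain whose first vertex has `slev ≤ i` and
whose last vertex has `slev ≥ i+1` crosses the line `slev = i ∣ i+1` at least once.
[cite: KrachunPanagiotis2026, §3.1] -/
theorem one_le_crossCount (i : ℤ) (l : List HV) (hc : l.IsChain hvGraph.Adj)
    (hh : ∃ v ∈ l.head?, slev v ≤ i) (hl : ∃ v ∈ l.getLast?, i + 1 ≤ slev v) :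
    1 ≤ crossCount i l := by
  cases l with
  | nil => simp at hh
  | cons a l =>
    simp only [List.head?_cons, Option.mem_def, Option.some.injEq, exists_eq_left'] at hh
    exact one_le_crossCount_cons i a l hc hh hl

/-! ### (4), (5): right exits of the triangle and the edges raising `slev` -/

/-- **(4) Right-exiting walks of `T_k` cross their exit line once** ("by definition, `k` is a renewal
time whenever the walk ends on the right side of Tria_{2k+1}"): for `P ∈ rightWalks k` — inner vertices
in `T_k = {0 ≤ x₁, -k ≤ x₀, slev ≤ k}`, final half-edge `((x₀,x₁,false), (x₀,x₁,true))` with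
`x₀ + x₁ = k` — the list crosses line `k` exactly once (at its final half-edge), every vertex but the
outer end has `slev ≤ k` (the first one, `w`, has `slev 0`), the outer end has `slev = k+1`, and the
exit height `x₁ = k - x₀` lies in `[0, 2k]`. [cite: KrachunPanagiotis2026, §3.1 (renewal times, N(γ))] -/
theorem rightWalks_crossings {k : ℕ} {P : List HV} (hP : P ∈ rightWalks k) :
    crossCount (k : ℤ) P = 1 ∧ (∀ v ∈ P.dropLast, slev v ≤ k) ∧ slev (finalDart P).2 = k + 1 ∧
      0 ≤ (finalDart P).1.2.1 ∧ (finalDart P).1.2.1 ≤ 2 * k := by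
  rw [rightWalks, Finset.mem_filter, mem_midWalks_iff] at hP
  obtain ⟨hW, hR⟩ := hP
  rcases hW.trivial_or_exists with rfl | ⟨l, u, hl, rfl⟩
  · exact absurd hR.2.1 (by rw [finalDart_trivial]; simp [wOut])
  rw [finalDart_cons_append hl] at hR ⊢
  obtain ⟨-, -, -, hV, -, -⟩ := (isMidWalk_cons_append_iff _ hl u).1 hW
  obtain ⟨hsum, hfalse, hu⟩ := hR
  dsimp only at hsum hfalse hu ⊢
  have hx := mem_triV_iff.1 (hV _ (List.getLast_mem hl))
  have hbit : bit (l.getLast hl) = 0 := by simp [bit, hfalse]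
  have hslev_x : slev (l.getLast hl) = k := by rw [slev, hbit]; omega
  have hslev_u : slev u = k + 1 := by rw [hu, slev_mk, bit_true]; omega
  have hlow : ∀ v ∈ wOut :: l, slev v ≤ k := by
    intro v hv
    rcases List.mem_cons.1 hv with rfl | hv
    · rw [slev_wOut]; omega
    · exact (mem_triV_iff.1 (hV v hv)).2.2
  refine ⟨?_, ?_, hslev_u, hx.1, by omega⟩
  · -- split the list at the last inner vertex: `(w :: l.dropLast) ++ (x :: [u])`
    have e : (wOut :: l.dropLast) ++ (l.getLast hl :: [u]) = wOut :: (l ++ [u]) := by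
      rw [List.append_cons, List.cons_append, List.dropLast_concat_getLast hl, List.cons_append]
    have hpos : (slev (l.getLast hl) = k ∧ slev u = k + 1) ∨
        (slev (l.getLast hl) = k + 1 ∧ slev u = k) := Or.inl ⟨hslev_x, hslev_u⟩
    rw [← e, crossCount_append_cons, List.cons_append, List.dropLast_concat_getLast hl,
      crossCount_eq_zero_of_forall_le (k : ℤ) (wOut :: l) hlow, crossCount_cons_cons_of_pos [] hpos,
      crossCount_singleton]
  · rw [← List.cons_append, List.dropLast_concat]
    exact hlow

/-- **(5) The edges raising the slanted level**: if `u ∼ v` and `slev v = slev u + 1` then `u` is an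
up-triangle `(x₀, x₁, false)` and `v = (x₀, x₁, true)` (the oblique edges keep `slev`, the edge
`{(x₀,x₁,false), (x₀,x₁,true)}` changes it by `±1`). [cite: KrachunPanagiotis2026, §3.1] -/
theorem eq_of_adj_of_slev_eq_succ {u v : HV} (h : hvGraph.Adj u v) (hs : slev v = slev u + 1) :
    v = (u.1, u.2.1, true) ∧ u.2.2 = false := by
  obtain ⟨a, b, c⟩ := u
  obtain ⟨a', b', c'⟩ := v
  cases c <;> cases c' <;> simp [hvGraph_adj, AdjRel, bit] at h hs ⊢ <;> omega

/-! ### The registered sub-goal -/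

/-- **Registered sub-goal `stub_kp_crossings`** (crux item stmt-CriticalPhenomena-0808, line
`root-locality-replaces-loewner`): the five elementary crossing facts of the Krachun–Panagiotis
renewal construction — (1) `crossCount` is monotone under appending; (2) appending vertices of
`slev ≥ i+1` after a last vertex of `slev ≥ i+1` adds no crossing of line `i`; (3) a chain from
`slev ≤ i` to `slev ≥ i+1` crosses line `i`; (4) a right-exiting walk of `T_k` crosses line `k` exactly
once, stays at `slev ≤ k` before its outer end (of `slev = k+1`), and exits at a height in `[0, 2k]`;
(5) only the edges `(x₀,x₁,false) → (x₀,x₁,true)` raise `slev` by one.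
[cite: KrachunPanagiotis2026, §3.1 (renewal times)] -/
theorem stub_kp_crossings : (∀ (i : ℤ) (l₁ l₂ : List Literature.Probability.RandomPlanarGeometry.SAW.HV), crossCount i l₁ ≤ crossCount i (l₁ ++ l₂)) ∧ (∀ (i : ℤ) (l₁ l₂ : List Literature.Probability.RandomPlanarGeometry.SAW.HV), (∀ v ∈ l₂, i + 1 ≤ slev v) → (∀ v ∈ l₁.getLast?, i + 1 ≤ slev v) → crossCount i (l₁ ++ l₂) = crossCount i l₁) ∧ (∀ (i : ℤ) (l : List Literature.Probability.RandomPlanarGeometry.SAW.HV), l.IsChain Literature.Probability.RandomPlanarGeometry.SAW.hvGraph.Adj → (∃ v ∈ l.head?, slev v ≤ i) → (∃ v ∈ l.getLast?, i + 1 ≤ slev v) → 1 ≤ crossCount i l) ∧ (∀ (k : ℕ) (P : List Literature.Probability.RandomPlanarGeometry.SAW.HV), P ∈ rightWalks k → crossCount (k : ℤ) P = 1 ∧ (∀ v ∈ P.dropLast, slev v ≤ k) ∧ slev (Literature.Probability.RandomPlanarGeometry.SAW.HV.finalDart P).2 = k + 1 ∧ 0 ≤ (Literature.Probability.RandomPlanarGeometry.SAW.HV.finalDart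 P).1.2.1 ∧ (Literature.Probability.RandomPlanarGeometry.SAW.HV.finalDart P).1.2.1 ≤ 2 * k) ∧ (∀ (u v : Literature.Probability.RandomPlanarGeometry.SAW.HV), Literature.Probability.RandomPlanarGeometry.SAW.hvGraph.Adj u v → slev v = slev u + 1 → v = (u.1, u.2.1, true) ∧ u.2.2 = false) :=
  ⟨crossCount_le_append, crossCount_append_eq, one_le_crossCount,
    fun _ _ hP => rightWalks_crossings hP, fun _ _ h hs => eq_of_adj_of_slev_eq_succ h hs⟩

end Summit.CriticalPhenomena.SAWScalingLimit.Theorems.HexConjecture.RootLocality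

end
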